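import Literature.AnabelianGeometry.SemiGraphs.ProfiniteSemiGraphIsoPullbackEquivalence
import Literature.AnabelianGeometry.SemiGraphs.ProfiniteSemiGraphIsoTransportApproximators
import Literature.AnabelianGeometry.SemiGraphs.TemperedCoveringsSubgraphBTemp
import HarnessLib

/-!
# Galois-countability, the charts of `π₁^temp` and the verticial / edge-like subgroups transport along
# isomorphisms of profinite presentations (route T, TRANSPORT VI)

Mochizuki, *Semi-graphs of anabelioids*, Publ. RIMS **42** (2006), §3 Prop. 3.6 (iv) p. 39 (a morphism
induces `B^temp(G') → B^temp(G)`), Thm. 3.7 (i)–(iv) pp. 40–41 (verticial and edge-like subgroups of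
`π₁^temp(G)`; compact subgroups; maximal compact subgroups) [cite: MochizukiSemiAnbd2006, Thm 3.7(iii)(iv) pp.40-41];
Galois-countability from [IUTchI] Rmk. 2.5.3 (i) (T2) p. 52.

For `F : X → Y` with `IsIso F.base` and bijective constituents (`Hom.IsLocallyTrivial`) — the data of
abc-iut-L3-t3's `Hom.IsoOver` with the base forgotten — on top of the pull-back equivalence
`B^temp(Y) ≌ B^temp(X)` (`ProfiniteSemiGraphIsoPullbackEquivalence.lean`):

* `isGaloisCountable_of_iso` — (T2) descends OBJECT-WISE (`CovObj.Splits.of_iso`,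
  `splits_covPullbackWith`), hence the hypotheses of Prop. 3.6 / Thm. 3.7 / Cor. 3.9 descend WITHOUT
  the strict-coherence input of TRANSPORT III (`prop36Hypotheses_of_iso'`, `thm37Hypotheses_of_iso'`,
  `cor39Hypotheses_of_iso'`) and ascend (`…_of_iso_symm`, along `F.inverse`);
* `SemiGraph.vertCard_edgeMap_of_isIso`, `isClosedEdge_edgeMap_iff_of_isIso` — closed edges correspond;
* along abc-iut's chart transport `TemperedPiChart.transport c e` (same group `Π`,
  `TemperedCoveringsSubgraphBTemp.lean`) with `e := F.btempPullbackEquiv hlt θ : B^temp(Y) ≌ B^temp(X)`: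
  the dictionary `verticialSubgroups (c.transport e) (F v) = verticialSubgroups c v`,
  `edgeLikeSubgroups (c.transport e) (F e) = edgeLikeSubgroups c e` (verticial / edge homomorphisms
  correspond by composing with `F_v⁻¹`, `F_v`);
Sequel (`ProfiniteSemiGraphIsoTransportAtBodies`): the BODIES of Thm 3.7 AT a graph transport both
ways.  Proof-only (abc-iut cell, L3 route T · TRANSPORT; seat abc-iut-L3-d6); no definition; nothing
here bears on [IUTchIII] Cor. 3.12.
-/

noncomputable section

open CategoryTheory Topology

namespace Literature.AnabelianGeometry.SemiGraphs

open Literature.AlgebraicGeometry.Frobenioids.QuasiTemperoid.BTempConnected (hom_ext_apply hom_ρ)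

universe u

/-! ### Verticial cardinalities and closed edges along an isomorphism of semi-graphs -/

namespace SemiGraph

variable {G G' : SemiGraph.{u}}

/-- An isomorphism of semi-graphs preserves verticial cardinalities (it is proper).
[cite: MochizukiSemiAnbd2006, §1 p.11] -/
theorem vertCard_edgeMap_of_isIso (f : G ⟶ G') [IsIso f] (e : G.Edge) :
    G'.vertCard (f.edgeMap e) = G.vertCard e := by
  refine Nat.card_congr ⟨fun b => ⟨(inv f).branchMap b.1, ?_⟩, fun b => ⟨f.branchMap b.1, ?_⟩,
    fun b => Subtype.ext (branchMap_inv_branchMap f b.1), fun b => Subtype.ext (inv_branchMap_branchMap f b.1)⟩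
  · obtain ⟨hb1, hb2⟩ := b.2
    obtain ⟨v, hv⟩ := Option.isSome_iff_exists.mp hb2
    refine ⟨by rw [(inv f).edgeOf_branchMap, hb1, inv_edgeMap_edgeMap], ?_⟩
    rw [(inv f).abuts_branchMap _ _ hv]
    rfl
  · obtain ⟨hb1, hb2⟩ := b.2
    obtain ⟨v, hv⟩ := Option.isSome_iff_exists.mp hb2
    refine ⟨by rw [f.edgeOf_branchMap, hb1], ?_⟩
    rw [f.abuts_branchMap _ _ hv]
    rfl

/-- Closed edges correspond under an isomorphism of semi-graphs. [cite: MochizukiSemiAnbd2006, §1 p.12] -/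
theorem isClosedEdge_edgeMap_iff_of_isIso (f : G ⟶ G') [IsIso f] (e : G.Edge) :
    G'.IsClosedEdge (f.edgeMap e) ↔ G.IsClosedEdge e := by
  unfold IsClosedEdge
  rw [vertCard_edgeMap_of_isIso]

/-- An isomorphism of semi-graphs is injective on edges. [cite: MochizukiSemiAnbd2006, §1 p.11] -/
theorem edgeMap_injective_of_isIso (f : G ⟶ G') [IsIso f] : Function.Injective f.edgeMap :=
  fun e₁ e₂ h => by rw [← inv_edgeMap_edgeMap f e₁, h, inv_edgeMap_edgeMap]

end SemiGraph

namespace ProfiniteSemiGraph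

variable {X Y : ProfiniteSemiGraph.{u}}

/-! ### Galois-countability descends object-wise; the §3 hypotheses without strict coherence -/

/-- Splitting over every constituent is invariant under isomorphism of the split object.
[cite: Mochizuki2012, IUTchI Rmk 2.5.3 (i) (T2), p. 52] -/
theorem CovObj.Splits.of_iso {P : ProfiniteSemiGraph.{u}} {T S S' : CovObj P} (e : S ≅ S')
    (h : T.Splits S') : T.Splits S := by
  refine ⟨fun v x g hx s => ?_, fun f x g hx s => ?_⟩
  · have h1 := h.1 v x g hx ((e.hom.fV v).hom.hom s)
    have h2 := congrArg (fun φ : S ⟶ S => (φ.fV v).hom.hom s) e.hom_inv_id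
    change (e.inv.fV v).hom.hom ((e.hom.fV v).hom.hom s) = s at h2
    rw [← h2]
    conv_rhs => rw [← h1]
    exact (hom_ρ (e.inv.fV v) g _).symm
  · have h1 := h.2 f x g hx ((e.hom.fE f).hom.hom s)
    have h2 := congrArg (fun φ : S ⟶ S => (φ.fE f).hom.hom s) e.hom_inv_id
    change (e.inv.fE f).hom.hom ((e.hom.fE f).hom.hom s) = s at h2
    rw [← h2]
    conv_rhs => rw [← h1]
    exact (hom_ρ (e.inv.fE f) g _).symm

namespace Hom

variable (F : Hom X Y) (θ : F.ConjugatorFamily)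

/-- Splitting is preserved by `F^*_θ`. [cite: Mochizuki2012, IUTchI Rmk 2.5.3 (i) (T2), p. 52] -/
theorem splits_covPullbackWith {T S : CovObj Y} (h : T.Splits S) :
    ((F.covPullbackWith θ).obj T).Splits ((F.covPullbackWith θ).obj S) :=
  ⟨fun v' x g' hx s => h.1 (F.base.vertexMap v') x (F.hV v' g') hx s,
    fun e' x g' hx s => h.2 (F.base.edgeMap e') x (F.hE e' g') hx s⟩

variable (hlt : F.IsLocallyTrivial) [IsIso (C := SemiGraph.{u}) F.base]

include F hlt

/-- **Galois-countability ([IUTchI] Rmk. 2.5.3 (i) (T2)) descends along an isomorphism of presentations**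
— object-wise: the countable cofinal family pulls back, and every finite object of `B^cov(X)` is the
pull-back of one of `B^cov(Y)` (`covPullbackEquiv`). [cite: Mochizuki2012, IUTchI Rmk 2.5.3 (i) (T2), p. 52] -/
theorem isGaloisCountable_of_iso (hY : Y.IsGaloisCountable) : X.IsGaloisCountable := by
  obtain ⟨hcnt, T, hT, hsplit⟩ := hY
  refine ⟨SemiGraph.isCountable_of_isIso F.base hcnt, fun i => (F.covPullbackWith F.chosenConjugators).obj (T i),
    fun i => ⟨F.isFinite_covPullbackWith _ (hT i).1, F.hasNonemptyFibres_covPullbackWith _ (hT i).2⟩,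
    fun H hH => ?_⟩
  obtain ⟨i, hi⟩ := hsplit (((F.inverse hlt).covPullbackWith
    (F.inverseConjugators hlt F.chosenConjugators)).obj H) ((F.inverse hlt).isFinite_covPullbackWith _ hH)
  exact ⟨i, CovObj.Splits.of_iso ((F.covPullbackCounitIso hlt F.chosenConjugators).app H).symm
    (F.splits_covPullbackWith _ hi)⟩

/-- **The hypotheses of [SemiAnbd] Prop. 3.6 descend along an isomorphism of presentations** (no
strict-coherence input: Galois-countability is transported object-wise; cf. TRANSPORT III
`prop36Hypotheses_of_iso`). [cite: MochizukiSemiAnbd2006, Prop 3.6 p.38] -/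
theorem prop36Hypotheses_of_iso' (h36 : Y.Prop36Hypotheses) : X.Prop36Hypotheses where
  isConnected := SemiGraph.isConnected_of_isIso' F.base h36.isConnected
  isCountable := SemiGraph.isCountable_of_isIso F.base h36.isCountable
  isGaloisCountable := F.isGaloisCountable_of_iso hlt h36.isGaloisCountable
  hasVertex := SemiGraph.nonempty_vertex_of_isIso F.base h36.hasVertex
  isOfInjectiveType := isOfInjectiveType_of_iso F hlt h36.isOfInjectiveType
  isQuasiCoherent := isQuasiCoherent_of_iso F hlt h36.isQuasiCoherent
  isTotallyElevated := isTotallyElevated_of_iso F hlt h36.isTotallyElevated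
  isTotallyAloof := isTotallyAloof_of_iso hlt h36.isTotallyAloof
  isVerticiallySlim := isVerticiallySlim_of_iso F hlt h36.isVerticiallySlim

/-- **The hypotheses of [SemiAnbd] Thm. 3.7 descend along an isomorphism of presentations** (no
strict-coherence input). [cite: MochizukiSemiAnbd2006, Thm 3.7 p.40] -/
theorem thm37Hypotheses_of_iso' (h37 : Y.Thm37Hypotheses) : X.Thm37Hypotheses where
  toProp36Hypotheses := F.prop36Hypotheses_of_iso' hlt h37.toProp36Hypotheses
  isTotallyEstranged := isTotallyEstranged_of_iso hlt h37.isTotallyEstranged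

/-- **The hypotheses of [SemiAnbd] Cor. 3.9 descend along an isomorphism of presentations** (no
strict-coherence input). [cite: MochizukiSemiAnbd2006, Cor 3.9 p.42] -/
theorem cor39Hypotheses_of_iso' (h39 : Cor39Hypotheses Y) : Cor39Hypotheses X where
  toProp36Hypotheses := F.prop36Hypotheses_of_iso' hlt h39.toProp36Hypotheses
  isTotallyEstranged := isTotallyEstranged_of_iso hlt h39.isTotallyEstranged
  isGraph := SemiGraph.isGraph_of_isIso F.base h39.isGraph

/-- … and ASCEND: the hypotheses of Thm. 3.7 pass from `X` to `Y` (descent along `F⁻¹`).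
[cite: MochizukiSemiAnbd2006, Thm 3.7 p.40] -/
theorem thm37Hypotheses_of_iso_symm (h37 : X.Thm37Hypotheses) : Y.Thm37Hypotheses :=
  (F.inverse hlt).thm37Hypotheses_of_iso' (F.inverse_isLocallyTrivial hlt) h37

/-- … and the hypotheses of Cor. 3.9 pass from `X` to `Y`. [cite: MochizukiSemiAnbd2006, Cor 3.9 p.42] -/
theorem cor39Hypotheses_of_iso_symm (h39 : Cor39Hypotheses X) : Cor39Hypotheses Y :=
  (F.inverse hlt).cor39Hypotheses_of_iso' (F.inverse_isLocallyTrivial hlt) h39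

end Hom

/-! ### Charts of `π₁^temp` transport with the same group -/

namespace TemperedPiChart

variable (F : Hom X Y) (hlt : F.IsLocallyTrivial) [IsIso (C := SemiGraph.{u}) F.base]

/-! The chart of `π₁^temp(Y)` attached to a chart `c` of `π₁^temp(X)` is abc-iut's
`TemperedPiChart.transport c e` (`TemperedCoveringsSubgraphBTemp.lean`: same group `Π`, equivalence
`e.trans c.equiv`) along the pull-back equivalence
`e := F.btempPullbackEquiv hlt F.chosenConjugators : B^temp(Y) ≌ B^temp(X)`. -/


/-- **Verticial homomorphisms transport**: if `χ : Π_{X,v} → Π` is verticial at `v` for `c`, then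
`χ ∘ F_v⁻¹ : Π_{Y,F v} → Π` is verticial at `F v` for the transported chart.
[cite: MochizukiSemiAnbd2006, Thm 3.7(i) p.40] -/
theorem isVerticialHom_transport (c : TemperedPiChart X) {v : X.graph.Vertex} {χ : X.Gv v →ₜ* c.G}
    (hχ : IsVerticialHom c v χ) :
    IsVerticialHom (c.transport (F.btempPullbackEquiv hlt F.chosenConjugators)) (F.base.vertexMap v)
      (χ.comp ((hlt.gvEquiv v).symm : Y.Gv (F.base.vertexMap v) →ₜ* X.Gv v)) := by
  obtain ⟨j⟩ := hχ
  let E := F.btempPullbackEquiv hlt F.chosenConjugators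
  let R : BTempCat Y ⥤ BTemp (Y.Gv (F.base.vertexMap v)) :=
    ObjectProperty.ι (fun S : CovObj Y => S.IsTempered) ⋙ restrictV Y (F.base.vertexMap v)
  let P : BTempCat X ⥤ BTemp (X.Gv v) := ObjectProperty.ι (fun S : CovObj X => S.IsTempered) ⋙ restrictV X v
  let ψ : Y.Gv (F.base.vertexMap v) →ₜ* X.Gv v := (hlt.gvEquiv v).symm
  let s1 : (c.equiv.inverse ⋙ E.inverse) ⋙ R ≅
      ((c.equiv.inverse ⋙ E.inverse) ⋙ R) ⋙ (BTemp.res (F.hV v) ⋙ BTemp.res ψ) :=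
    (Functor.rightUnitor _).symm ≪≫ Functor.isoWhiskerLeft _
      (NatIso.ofComponents (fun M => BTemp.resResIso (F.hV v) ψ (hlt.hV_gvEquiv_symm v) M)
        (fun _ => hom_ext_apply fun _ => rfl) : 𝟭 _ ≅ BTemp.res (F.hV v) ⋙ BTemp.res ψ)
  let s2 : ((c.equiv.inverse ⋙ E.inverse) ⋙ R) ⋙ (BTemp.res (F.hV v) ⋙ BTemp.res ψ) ≅
      (c.equiv.inverse ⋙ ((E.inverse ⋙ E.functor) ⋙ P)) ⋙ BTemp.res ψ := Iso.refl _
  let s3 : (c.equiv.inverse ⋙ ((E.inverse ⋙ E.functor) ⋙ P)) ⋙ BTemp.res ψ ≅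
      (c.equiv.inverse ⋙ P) ⋙ BTemp.res ψ :=
    Functor.isoWhiskerRight (Functor.isoWhiskerLeft c.equiv.inverse
      (Functor.isoWhiskerRight E.counitIso P ≪≫ P.leftUnitor)) (BTemp.res ψ)
  exact ⟨s1 ≪≫ s2 ≪≫ s3 ≪≫ Functor.isoWhiskerRight j (BTemp.res ψ) ≪≫ BTemp.resComp χ ψ⟩

/-- … and conversely: if `ψ : Π_{Y,F v} → Π` is verticial at `F v` for the transported chart, then
`ψ ∘ F_v` is verticial at `v` for `c`. [cite: MochizukiSemiAnbd2006, Thm 3.7(i) p.40] -/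
theorem isVerticialHom_of_transport (c : TemperedPiChart X) {v : X.graph.Vertex}
    {ψ : Y.Gv (F.base.vertexMap v) →ₜ* c.G} (hψ : IsVerticialHom (c.transport (F.btempPullbackEquiv hlt F.chosenConjugators)) (F.base.vertexMap v) ψ) :
    IsVerticialHom c v (ψ.comp (F.hV v)) := by
  obtain ⟨j⟩ := hψ
  let E := F.btempPullbackEquiv hlt F.chosenConjugators
  let R : BTempCat Y ⥤ BTemp (Y.Gv (F.base.vertexMap v)) :=
    ObjectProperty.ι (fun S : CovObj Y => S.IsTempered) ⋙ restrictV Y (F.base.vertexMap v)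
  let P : BTempCat X ⥤ BTemp (X.Gv v) := ObjectProperty.ι (fun S : CovObj X => S.IsTempered) ⋙ restrictV X v
  let s1 : BTemp.res ψ ⋙ BTemp.res (F.hV v) ≅ ((c.equiv.inverse ⋙ E.inverse) ⋙ R) ⋙ BTemp.res (F.hV v) :=
    Functor.isoWhiskerRight j.symm (BTemp.res (F.hV v))
  let s2 : ((c.equiv.inverse ⋙ E.inverse) ⋙ R) ⋙ BTemp.res (F.hV v) ≅
      c.equiv.inverse ⋙ ((E.inverse ⋙ E.functor) ⋙ P) := Iso.refl _
  let s3 : c.equiv.inverse ⋙ ((E.inverse ⋙ E.functor) ⋙ P) ≅ c.equiv.inverse ⋙ P :=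
    Functor.isoWhiskerLeft c.equiv.inverse (Functor.isoWhiskerRight E.counitIso P ≪≫ P.leftUnitor)
  exact ⟨((BTemp.resComp ψ (F.hV v)).symm ≪≫ s1 ≪≫ s2 ≪≫ s3).symm⟩

/-- **Edge homomorphisms transport.** [cite: MochizukiSemiAnbd2006, Thm 3.7(iii) p.41] -/
theorem isEdgeHom_transport (c : TemperedPiChart X) {e : X.graph.Edge} {χ : X.Ge e →ₜ* c.G}
    (hχ : IsEdgeHom c e χ) :
    IsEdgeHom (c.transport (F.btempPullbackEquiv hlt F.chosenConjugators)) (F.base.edgeMap e)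
      (χ.comp ((hlt.geEquiv e).symm : Y.Ge (F.base.edgeMap e) →ₜ* X.Ge e)) := by
  obtain ⟨j⟩ := hχ
  let E := F.btempPullbackEquiv hlt F.chosenConjugators
  let R : BTempCat Y ⥤ BTemp (Y.Ge (F.base.edgeMap e)) :=
    ObjectProperty.ι (fun S : CovObj Y => S.IsTempered) ⋙ restrictE Y (F.base.edgeMap e)
  let P : BTempCat X ⥤ BTemp (X.Ge e) := ObjectProperty.ι (fun S : CovObj X => S.IsTempered) ⋙ restrictE X e
  let ψ : Y.Ge (F.base.edgeMap e) →ₜ* X.Ge e := (hlt.geEquiv e).symm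
  let s1 : (c.equiv.inverse ⋙ E.inverse) ⋙ R ≅
      ((c.equiv.inverse ⋙ E.inverse) ⋙ R) ⋙ (BTemp.res (F.hE e) ⋙ BTemp.res ψ) :=
    (Functor.rightUnitor _).symm ≪≫ Functor.isoWhiskerLeft _
      (NatIso.ofComponents (fun M => BTemp.resResIso (F.hE e) ψ (hlt.hE_geEquiv_symm e) M)
        (fun _ => hom_ext_apply fun _ => rfl) : 𝟭 _ ≅ BTemp.res (F.hE e) ⋙ BTemp.res ψ)
  let s2 : ((c.equiv.inverse ⋙ E.inverse) ⋙ R) ⋙ (BTemp.res (F.hE e) ⋙ BTemp.res ψ) ≅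
      (c.equiv.inverse ⋙ ((E.inverse ⋙ E.functor) ⋙ P)) ⋙ BTemp.res ψ := Iso.refl _
  let s3 : (c.equiv.inverse ⋙ ((E.inverse ⋙ E.functor) ⋙ P)) ⋙ BTemp.res ψ ≅
      (c.equiv.inverse ⋙ P) ⋙ BTemp.res ψ :=
    Functor.isoWhiskerRight (Functor.isoWhiskerLeft c.equiv.inverse
      (Functor.isoWhiskerRight E.counitIso P ≪≫ P.leftUnitor)) (BTemp.res ψ)
  exact ⟨s1 ≪≫ s2 ≪≫ s3 ≪≫ Functor.isoWhiskerRight j (BTemp.res ψ) ≪≫ BTemp.resComp χ ψ⟩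

/-- … and conversely. [cite: MochizukiSemiAnbd2006, Thm 3.7(iii) p.41] -/
theorem isEdgeHom_of_transport (c : TemperedPiChart X) {e : X.graph.Edge}
    {ψ : Y.Ge (F.base.edgeMap e) →ₜ* c.G} (hψ : IsEdgeHom (c.transport (F.btempPullbackEquiv hlt F.chosenConjugators)) (F.base.edgeMap e) ψ) :
    IsEdgeHom c e (ψ.comp (F.hE e)) := by
  obtain ⟨j⟩ := hψ
  let E := F.btempPullbackEquiv hlt F.chosenConjugators
  let R : BTempCat Y ⥤ BTemp (Y.Ge (F.base.edgeMap e)) :=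
    ObjectProperty.ι (fun S : CovObj Y => S.IsTempered) ⋙ restrictE Y (F.base.edgeMap e)
  let P : BTempCat X ⥤ BTemp (X.Ge e) := ObjectProperty.ι (fun S : CovObj X => S.IsTempered) ⋙ restrictE X e
  let s1 : BTemp.res ψ ⋙ BTemp.res (F.hE e) ≅ ((c.equiv.inverse ⋙ E.inverse) ⋙ R) ⋙ BTemp.res (F.hE e) :=
    Functor.isoWhiskerRight j.symm (BTemp.res (F.hE e))
  let s2 : ((c.equiv.inverse ⋙ E.inverse) ⋙ R) ⋙ BTemp.res (F.hE e) ≅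
      c.equiv.inverse ⋙ ((E.inverse ⋙ E.functor) ⋙ P) := Iso.refl _
  let s3 : c.equiv.inverse ⋙ ((E.inverse ⋙ E.functor) ⋙ P) ≅ c.equiv.inverse ⋙ P :=
    Functor.isoWhiskerLeft c.equiv.inverse (Functor.isoWhiskerRight E.counitIso P ≪≫ P.leftUnitor)
  exact ⟨((BTemp.resComp ψ (F.hE e)).symm ≪≫ s1 ≪≫ s2 ≪≫ s3).symm⟩

/-- The range of `φ ∘ e` for a surjective `e` is the range of `φ`. [folklore] -/
private theorem range_comp_of_surjective {A B C : Type u} [Group A] [TopologicalSpace A] [Group B]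
    [TopologicalSpace B] [Group C] [TopologicalSpace C] (φ : B →ₜ* C) (e : A →ₜ* B)
    (he : Function.Surjective e) : (φ.comp e).toMonoidHom.range = φ.toMonoidHom.range := by
  ext z
  constructor
  · rintro ⟨a, rfl⟩
    exact ⟨e a, rfl⟩
  · rintro ⟨b, rfl⟩
    obtain ⟨a, rfl⟩ := he b
    exact ⟨a, rfl⟩

/-- **The verticial subgroups at `F v` for the transported chart ARE the verticial subgroups at `v`**
(same subgroups of the same group `Π`). [cite: MochizukiSemiAnbd2006, Thm 3.7(i) p.40] -/
theorem verticialSubgroups_transport (c : TemperedPiChart X) (v : X.graph.Vertex) :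
    verticialSubgroups (c.transport (F.btempPullbackEquiv hlt F.chosenConjugators)) (F.base.vertexMap v) = verticialSubgroups c v := by
  ext H
  constructor
  · rintro ⟨ψ, hψ, rfl⟩
    exact ⟨ψ.comp (F.hV v), c.isVerticialHom_of_transport F hlt hψ,
      (range_comp_of_surjective ψ (F.hV v) (hlt.1 v).2).symm⟩
  · rintro ⟨χ, hχ, rfl⟩
    exact ⟨χ.comp ((hlt.gvEquiv v).symm : Y.Gv (F.base.vertexMap v) →ₜ* X.Gv v),
      c.isVerticialHom_transport F hlt hχ,
      (range_comp_of_surjective χ ((hlt.gvEquiv v).symm : Y.Gv (F.base.vertexMap v) →ₜ* X.Gv v)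
        (hlt.gvEquiv v).symm.surjective).symm⟩

/-- **The edge-like subgroups at `F e` for the transported chart ARE the edge-like subgroups at `e`.**
[cite: MochizukiSemiAnbd2006, Thm 3.7(iii) p.41] -/
theorem edgeLikeSubgroups_transport (c : TemperedPiChart X) (e : X.graph.Edge) :
    edgeLikeSubgroups (c.transport (F.btempPullbackEquiv hlt F.chosenConjugators)) (F.base.edgeMap e) = edgeLikeSubgroups c e := by
  ext L
  constructor
  · rintro ⟨ψ, hψ, rfl⟩
    exact ⟨ψ.comp (F.hE e), c.isEdgeHom_of_transport F hlt hψ,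
      (range_comp_of_surjective ψ (F.hE e) (hlt.2 e).2).symm⟩
  · rintro ⟨χ, hχ, rfl⟩
    exact ⟨χ.comp ((hlt.geEquiv e).symm : Y.Ge (F.base.edgeMap e) →ₜ* X.Ge e),
      c.isEdgeHom_transport F hlt hχ,
      (range_comp_of_surjective χ ((hlt.geEquiv e).symm : Y.Ge (F.base.edgeMap e) →ₜ* X.Ge e)
        (hlt.geEquiv e).symm.surjective).symm⟩

/-- The dictionary at a vertex `w` of `Y`, read through `F⁻¹`. [cite: MochizukiSemiAnbd2006, Thm 3.7(i) p.40] -/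
theorem verticialSubgroups_transport' (c : TemperedPiChart X) (w : Y.graph.Vertex) :
    verticialSubgroups (c.transport (F.btempPullbackEquiv hlt F.chosenConjugators)) w = verticialSubgroups c ((inv (C := SemiGraph.{u}) F.base).vertexMap w) := by
  rw [← c.verticialSubgroups_transport F hlt, SemiGraph.vertexMap_inv_vertexMap]

/-- The dictionary at an edge `e` of `Y`, read through `F⁻¹`. [cite: MochizukiSemiAnbd2006, Thm 3.7(iii) p.41] -/
theorem edgeLikeSubgroups_transport' (c : TemperedPiChart X) (e : Y.graph.Edge) :
    edgeLikeSubgroups (c.transport (F.btempPullbackEquiv hlt F.chosenConjugators)) e = edgeLikeSubgroups c ((inv (C := SemiGraph.{u}) F.base).edgeMap e) := by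
  rw [← c.edgeLikeSubgroups_transport F hlt, SemiGraph.edgeMap_inv_edgeMap]

end TemperedPiChart

end ProfiniteSemiGraph

end Literature.AnabelianGeometry.SemiGraphs

end
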